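/-
Origin: expansion seat `prover-pub-hodgecm-htheta-x1-g6-0`, handover #M3 2026-08-21T20:34Z md5 a336317c3e0d (NEW; 101 l.; (M3) package leaf (P1) thetaRealisation₂_faceσ_of_GRU_thm418C / (P2) exists_thetaRealisation₂_face / exists_thetaRealisation₂_face_mu; imports HodgeCM.Model.PeriodThmFFace only; E-neutral; T5 HOME/INBOX l.269; worded by COORDINATOR RULING post-Δ2 22:05:29Z (3)) (`HOME/pub-hodgecm-own-htheta/x1/pkg/ThetaRealisationFace.lean`, md5 a336317c3e0d, 101 lines);
landed by the p-seat packager p gen 33 (p-g33) in gate run 82 as `HodgeCM/Model/ThetaRealisationFace.lean` (verbatim).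
-/
/-
Copyright (c) 2026 the pub-hodgecm formalisation cell (harness21).  New file, not vendored.
Origin: seat `prover-pub-hodgecm-htheta-x1-g6-0` (unit pub-hodgecm-htheta-x1 gen 6, item-(vi) lineage under own-htheta), 2026-08-21 — OFF-LANE DRAFT of the
deferred package leaf (M3) of stage-1 lead word 1-g104 (pub-hodgecm STATUS l.16462, «NO CUT TONIGHT — PKG frozen r81; own-htheta g3 ∕ htheta-x1 MAY DRAFT the
leaf OFF-LANE»), requested by own-b01 g2 for HM-EQUALITY open item (b) «quantifier-head witness supply for a general face» (pub-hodgecm2 INBOX l.5501):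
(P1) `thetaRealisation₂_faceσ_of_GRU_thm418C` — the binders of `periodNV_faceσ_of_GRU_thm418C` (`Model/PeriodThmFFace.lean` :75–86, r81 6ed5ad416eb5)
with the conclusion `Nonempty (ThetaRealisation₂ ι₁ V F f.psi σ)` (the first half of its proof: the record IS the intermediate before `thm44_of_realisation₂`);
(P2) `exists_thetaRealisation₂_face (hGRU) (μ) (h418) : ∀ F [IsGalois ℚ F], 6 ≤ finrank ℚ F → ∀ f : Face F, ∃ ι₁ V σ, Nonempty (ThetaRealisation₂ ι₁ V F f.psi σ)`
— the FACE-QUANTIFIED head whose TYPE is the hypothesis `h` of the tree heads `Model.hc_cm_of_thetaRealisation₂_rec` (p301965) ∕ `…_abs_rec` (p301710):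
σ := an admissible embedding (`StubTree.admissible_exists`), ι₁ := the representative of its place (`exists_representative_comp_eq`, `mk_embedding`),
V := `StubTree.landherr_exists`.  Target in PKG: `HodgeCM/Model/ThetaRealisationFace.lean` (NEW additive leaf; imports `Model/PeriodThmFFace` only; nothing
of record imports it; E «JBUARM» untouched — E-NEUTRAL: the conclusions are `Nonempty`/`∃`, not `PerL`).  KERNEL ONLY: 3 theorems, no `def`, no proof hole,
no new input; binder groups EXACTLY `hGRU` ([GR91 Prop 3.1.1] verbatim), `μ` (free exponent table), `h418` (the r8 reading `Thm418C` of [Liu21 Thm 4.18]).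
HC_CM is NOT proved; nothing here is a claim of the manuscripts under adjudication.
-/
import Summits.HodgeConjecture.HodgeCM.Model.PeriodThmFFace

/-! PORT of `HodgeCM/Model/ThetaRealisationFace.lean` (HodgeCMPerL run 82) — verbatim mechanical port; provenance in the PORT header line. -/

set_option autoImplicit false

noncomputable section

namespace HodgeCM.Model

open Literature.AlgebraicGeometry.HodgeTheory Literature.NumberTheory.Automorphic.PicardCM
open Literature.NumberTheory.GelbartRogawski1991.UnitaryDualPair
open HodgeCM.Universe (ModelAxiomsPerL)
open NumberField

variable (hHD : exists_isReal_hodgeModel) (hI : hodgePQ_independent_of_hodgeModel)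
  (h₁ : BallQuotientUniformised) (h₃ : CMAbelianVarietyEigenbasisRealised)

/-- **(P1) `ThetaRealisation₂` AT A FACE, σ-decoupled form** — the binders of `periodNV_faceσ_of_GRU_thm418C` (eigen-embedding `σ` ADMISSIBLE, surface
embedding `ι₁` the canonical representative with `ι₁ ∘ j = σ`), conclusion the MEETING-FORM REALISATION RECORD itself (the intermediate of that proof, before
the engine `thm44_of_realisation₂`): lines `D` along `j` by `ThetaModel.exists_seesawDatum`, guard by #H22 `goodCtx_faceCtxσ`, record by #H40
`thetaRealisation₂_picardCM_r20AEOGISTR2DJWHHTCGJBUAR_gal` at `faceCtxσ F f σ D = ⟨F, f.psi, σ, D⟩` (scope `⟨h6, isNormalClosure_self_of_isGalois F⟩`). [folklore] -/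
theorem thetaRealisation₂_faceσ_of_GRU_thm418C
    (hGRU : ∀ (L : Type) [Field L] [NumberField L] [NumberField.IsCMField L] {N M n : ℕ} (e : Fin N × Fin M ≃ Fin n)
      (dV : Fin N → L) (hdV : ∀ i, NumberField.IsCMField.complexConj L (dV i) = dV i) (hdV0 : ∀ i, dV i ≠ 0)
      (dW : Fin M → L) (hdW : ∀ i, NumberField.IsCMField.complexConj L (dW i) = dW i) (hdW0 : ∀ i, dW i ≠ 0),
      (cmSplittingDatum L e dV hdV hdV0 dW hdW hdW0).CompatibleSplitting)
    (μ : ∀ {L : CMField}, SeesawCtx L → Fin 4 → NumberField.InfinitePlace L → ℤ)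
    (h418 : ∀ {L : CMField} {ι₁ : L →+* ℂ} (V : HermSpace3 L ι₁), (NumberField.InfinitePlace.mk ι₁).embedding = ι₁ → ∀ a₀ : LiuIndex.RealScalar L,
      (liuDictionaryPin hHD hI h₁ (cmAbelianVarietyRealised_of_eigenbasis hHD hI h₃) Literature.NumberTheory.Transcendental.arapura2012_cor_15_4_6_holds V
          (LiuIndex.I V (LiuIndex.repAt a₀) (LiuIndex.muLiu ι₁ LiuIndex.GramClass.rep))
          (LiuIndex.line V (LiuIndex.repAt a₀) (LiuIndex.muLiu ι₁ LiuIndex.GramClass.rep))).Thm418C)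
    (F : CMField) [IsGalois ℚ F] (h6 : 6 ≤ Module.finrank ℚ F) (f : Face F) {σ ι₁ : F →+* ℂ} (hadm : f.Admissible σ)
    (j : F →+* F) (hj : ι₁.comp j = σ) (hcan : (NumberField.InfinitePlace.mk ι₁).embedding = ι₁) (V : HermSpace3 F ι₁) :
    Nonempty ((picardCMUniverse hHD hI h₁ (cmAbelianVarietyRealised_of_eigenbasis hHD hI h₃)).ThetaRealisation₂ ι₁ V F f.psi σ) := by
  have hex : ∃ D : StubTree.SeesawDatum F,
      (thetaModelOf hHD hI h₁ (cmAbelianVarietyRealised_of_eigenbasis hHD hI h₃) (orientBitι F ι₁) (embOf hHD hI h₁ (cmAbelianVarietyRealised_of_eigenbasis hHD hI h₃)) (coverOf hHD hI h₁ (cmAbelianVarietyRealised_of_eigenbasis hHD hI h₃) Literature.NumberTheory.Transcendental.arapura2012_cor_15_4_6_holds) (wmOfInput (HypCensus.Wcm (@SInstance.GRU.hGR hGRU) (@EtaChi.η (@SInstance.χVR (@SInstance.GRU.hGR hGRU) (@SInstance.GRU.hGR₀ hGRU) (@SInstance.GRU.hGR₁ hGRU)) (@SInstance.χWR (@SInstance.GRU.hGR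 hGRU) (@SInstance.GRU.hGR₀ hGRU) (@SInstance.GRU.hGR₁ hGRU) (ArchSideTerm.muSharp₂₃ @μ))) (@EtaChi.hη (@SInstance.χVR (@SInstance.GRU.hGR hGRU) (@SInstance.GRU.hGR₀ hGRU) (@SInstance.GRU.hGR₁ hGRU)) (@SInstance.χWR (@SInstance.GRU.hGR hGRU) (@SInstance.GRU.hGR₀ hGRU) (@SInstance.GRU.hGR₁ hGRU) (ArchSideTerm.muSharp₂₃ @μ))) (@EtaChi.hηc (@SInstance.χVR (@SInstance.GRU.hGR hGRU) (@SInstance.GRU.hGR₀ hGRU) (@SInstance.GRU.hGR₁ hGRU)) (@SInstance.χWR (@SInstance.GRU.hGR hGRU) (@SInstance.GRU.hGR₀ hGRU) (@SInstance.GRU.hGR₁ hGRU) (ArchSideTerm.muSharp₂₃ @μ))))) (thetaOf _ (thetaClassInputOf _ (fun V c => thetaSpaceInputOf hHD hI h₁ (cmAbelianVarietyRealised_of_eigenbasis hHD hI h₃) (SInstance.SROGT'C (@SInstance.GRU.hGR hGRU) (@SInstance.GRU.hGR₀ hGRU) (@SInstance.GRU.hGR₁ hGRU) (@SInstance.GRU.hGR₂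 hGRU) (@SInstance.GRU.hGR₃ hGRU) (ArchSideTerm.muSharp₂₃ @μ) (ArchSideTerm.hΔ₁_GOG_muSharp₂₃ (@SInstance.GRU.hGR hGRU) (@SInstance.GRU.hGR₀ hGRU) (@SInstance.GRU.hGR₁ hGRU) (@SInstance.GRU.hGR₂ hGRU) (@SInstance.GRU.hGR₃ hGRU) @μ) (ArchSideTerm.hΔ₂_GOG_muSharp₂₃ (@SInstance.GRU.hGR hGRU) (@SInstance.GRU.hGR₀ hGRU) (@SInstance.GRU.hGR₁ hGRU) (@SInstance.GRU.hGR₂ hGRU) (@SInstance.GRU.hGR₃ hGRU) @μ (ArchSideTerm.hSV_holds (@SInstance.GRU.hGR hGRU))) (ArchSideTerm.hΔ₃_GOG_muSharp₂₃ (@SInstance.GRU.hGR hGRU) (@SInstance.GRU.hGR₀ hGRU) (@SInstance.GRU.hGR₁ hGRU) (@SInstance.GRU.hGR₂ hGRU) (@SInstance.GRU.hGR₃ hGRU) @μ (ArchSideTerm.hSV_holds (@SInstance.GRU.hGR hGRU)))) V c))) (d12Of (ArchSideTerm.muSharp₂₃ @μ)) (d34Of (ArchSideTerm.muSharp₂₃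 @μ))).GoodCtx ι₁ (faceCtxσ F f σ D) := by
    obtain ⟨D, hD⟩ := (thetaModelOf hHD hI h₁ (cmAbelianVarietyRealised_of_eigenbasis hHD hI h₃) (orientBitι F ι₁) (embOf hHD hI h₁ (cmAbelianVarietyRealised_of_eigenbasis hHD hI h₃)) (coverOf hHD hI h₁ (cmAbelianVarietyRealised_of_eigenbasis hHD hI h₃) Literature.NumberTheory.Transcendental.arapura2012_cor_15_4_6_holds) (wmOfInput (HypCensus.Wcm (@SInstance.GRU.hGR hGRU) (@EtaChi.η (@SInstance.χVR (@SInstance.GRU.hGR hGRU) (@SInstance.GRU.hGR₀ hGRU) (@SInstance.GRU.hGR₁ hGRU)) (@SInstance.χWR (@SInstance.GRU.hGR hGRU) (@SInstance.GRU.hGR₀ hGRU) (@SInstance.GRU.hGR₁ hGRU) (ArchSideTerm.muSharp₂₃ @μ))) (@EtaChi.hη (@SInstance.χVR (@SInstance.GRU.hGR hGRU) (@SInstance.GRU.hGR₀ hGRU) (@SInstance.GRU.hGR₁ hGRU)) (@SInstance.χWR (@SInstance.GRU.hGR hGRU) (@SInstance.GRU.hGR₀ hGRU) (@SInstance.GRU.hGR₁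 hGRU) (ArchSideTerm.muSharp₂₃ @μ))) (@EtaChi.hηc (@SInstance.χVR (@SInstance.GRU.hGR hGRU) (@SInstance.GRU.hGR₀ hGRU) (@SInstance.GRU.hGR₁ hGRU)) (@SInstance.χWR (@SInstance.GRU.hGR hGRU) (@SInstance.GRU.hGR₀ hGRU) (@SInstance.GRU.hGR₁ hGRU) (ArchSideTerm.muSharp₂₃ @μ))))) (thetaOf _ (thetaClassInputOf _ (fun V c => thetaSpaceInputOf hHD hI h₁ (cmAbelianVarietyRealised_of_eigenbasis hHD hI h₃) (SInstance.SROGT'C (@SInstance.GRU.hGR hGRU) (@SInstance.GRU.hGR₀ hGRU) (@SInstance.GRU.hGR₁ hGRU) (@SInstance.GRU.hGR₂ hGRU) (@SInstance.GRU.hGR₃ hGRU) (ArchSideTerm.muSharp₂₃ @μ) (ArchSideTerm.hΔ₁_GOG_muSharp₂₃ (@SInstance.GRU.hGR hGRU) (@SInstance.GRU.hGR₀ hGRU) (@SInstance.GRU.hGR₁ hGRU) (@SInstance.GRU.hGR₂ hGRU) (@SInstance.GRU.hGR₃ hGRU) @μ) (ArchSideTerm.hΔ₂_GOG_muSharp₂₃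 (@SInstance.GRU.hGR hGRU) (@SInstance.GRU.hGR₀ hGRU) (@SInstance.GRU.hGR₁ hGRU) (@SInstance.GRU.hGR₂ hGRU) (@SInstance.GRU.hGR₃ hGRU) @μ (ArchSideTerm.hSV_holds (@SInstance.GRU.hGR hGRU))) (ArchSideTerm.hΔ₃_GOG_muSharp₂₃ (@SInstance.GRU.hGR hGRU) (@SInstance.GRU.hGR₀ hGRU) (@SInstance.GRU.hGR₁ hGRU) (@SInstance.GRU.hGR₂ hGRU) (@SInstance.GRU.hGR₃ hGRU) @μ (ArchSideTerm.hSV_holds (@SInstance.GRU.hGR hGRU)))) V c))) (d12Of (ArchSideTerm.muSharp₂₃ @μ)) (d34Of (ArchSideTerm.muSharp₂₃ @μ))).exists_seesawDatum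
      (Universe.AdelicThetaCore.design_kappaConj _ _ _ _) (Universe.AdelicThetaCore.design_frameSignConj _ _ _ _)
      lemma33bLandherr_holds j ι₁ f.psi (pairSum_psi f)
    exact ⟨D, goodCtx_faceCtxσ _ F f hadm j hj D hD⟩
  obtain ⟨D, hgood⟩ := hex
  exact thetaRealisation₂_picardCM_r20AEOGISTR2DJWHHTCGJBUAR_gal hHD hI h₁ h₃ hGRU μ h418 V (faceCtxσ F f σ D) hgood
    ⟨h6, isNormalClosure_self_of_isGalois F⟩ hcan

/-- **(P2) `ThetaRealisation₂` AT EVERY FACE — the face-quantified head** (exponent table `μ` free): for every Galois CM `F` with `6 ≤ [F:ℚ]` and every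
rank-four face `f` there are `ι₁`, `V`, `σ` with `Nonempty (ThetaRealisation₂ ι₁ V F f.psi σ)`: `σ` an admissible embedding (`StubTree.admissible_exists`),
`ι₁ := (mk σ).embedding` the canonical representative of its place with `j` from `exists_representative_comp_eq` (so `hcan` holds by `mk_embedding`),
`V` from `StubTree.landherr_exists`, then (P1).  Its TYPE (under the package's `Universe` field names) is the hypothesis `h` of the tree heads
`Model.hc_cm_of_thetaRealisation₂_rec` (p301965) ∕ `Model.hc_cm_of_thetaRealisation₂_abs_rec` (p301710) — HM-EQUALITY item (b). [folklore] -/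
theorem exists_thetaRealisation₂_face_mu
    (hGRU : ∀ (L : Type) [Field L] [NumberField L] [NumberField.IsCMField L] {N M n : ℕ} (e : Fin N × Fin M ≃ Fin n)
      (dV : Fin N → L) (hdV : ∀ i, NumberField.IsCMField.complexConj L (dV i) = dV i) (hdV0 : ∀ i, dV i ≠ 0)
      (dW : Fin M → L) (hdW : ∀ i, NumberField.IsCMField.complexConj L (dW i) = dW i) (hdW0 : ∀ i, dW i ≠ 0),
      (cmSplittingDatum L e dV hdV hdV0 dW hdW hdW0).CompatibleSplitting)
    (μ : ∀ {L : CMField}, SeesawCtx L → Fin 4 → NumberField.InfinitePlace L → ℤ)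
    (h418 : ∀ {L : CMField} {ι₁ : L →+* ℂ} (V : HermSpace3 L ι₁), (NumberField.InfinitePlace.mk ι₁).embedding = ι₁ → ∀ a₀ : LiuIndex.RealScalar L,
      (liuDictionaryPin hHD hI h₁ (cmAbelianVarietyRealised_of_eigenbasis hHD hI h₃) Literature.NumberTheory.Transcendental.arapura2012_cor_15_4_6_holds V
          (LiuIndex.I V (LiuIndex.repAt a₀) (LiuIndex.muLiu ι₁ LiuIndex.GramClass.rep))
          (LiuIndex.line V (LiuIndex.repAt a₀) (LiuIndex.muLiu ι₁ LiuIndex.GramClass.rep))).Thm418C)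
    (F : CMField) [IsGalois ℚ F] (h6 : 6 ≤ Module.finrank ℚ F) (f : Face F) :
    ∃ (ι₁ : F →+* ℂ) (V : HermSpace3 F ι₁) (σ : F →+* ℂ),
      Nonempty ((picardCMUniverse hHD hI h₁ (cmAbelianVarietyRealised_of_eigenbasis hHD hI h₃)).ThetaRealisation₂ ι₁ V F f.psi σ) := by
  obtain ⟨σ, hadm⟩ := StubTree.admissible_exists F h6 f
  obtain ⟨j, hj⟩ := exists_representative_comp_eq F σ
  obtain ⟨V⟩ := StubTree.landherr_exists F (NumberField.InfinitePlace.mk σ).embedding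
  exact ⟨(NumberField.InfinitePlace.mk σ).embedding, V, σ,
    thetaRealisation₂_faceσ_of_GRU_thm418C hHD hI h₁ h₃ hGRU μ h418 F h6 f hadm j hj (by rw [NumberField.InfinitePlace.mk_embedding]) V⟩

/-- **RECORD SHAPE of (P2)**: binder groups EXACTLY «JBUARM»'s (`hGRU`, `h418`); own-mu's `μ := muSharp₂₃ muSlotZero` plugged in (the conclusion does
not mention `μ`).  `∀ F [IsGalois ℚ F], 6 ≤ finrank ℚ F → ∀ f : Face F, ∃ ι₁ V σ, Nonempty (ThetaRealisation₂ ι₁ V F f.psi σ)`. [folklore] -/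
theorem exists_thetaRealisation₂_face
    (hGRU : ∀ (L : Type) [Field L] [NumberField L] [NumberField.IsCMField L] {N M n : ℕ} (e : Fin N × Fin M ≃ Fin n)
      (dV : Fin N → L) (hdV : ∀ i, NumberField.IsCMField.complexConj L (dV i) = dV i) (hdV0 : ∀ i, dV i ≠ 0)
      (dW : Fin M → L) (hdW : ∀ i, NumberField.IsCMField.complexConj L (dW i) = dW i) (hdW0 : ∀ i, dW i ≠ 0),
      (cmSplittingDatum L e dV hdV hdV0 dW hdW hdW0).CompatibleSplitting)
    (h418 : ∀ {L : CMField} {ι₁ : L →+* ℂ} (V : HermSpace3 L ι₁), (NumberField.InfinitePlace.mk ι₁).embedding = ι₁ → ∀ a₀ : LiuIndex.RealScalar L,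
      (liuDictionaryPin hHD hI h₁ (cmAbelianVarietyRealised_of_eigenbasis hHD hI h₃) Literature.NumberTheory.Transcendental.arapura2012_cor_15_4_6_holds V
          (LiuIndex.I V (LiuIndex.repAt a₀) (LiuIndex.muLiu ι₁ LiuIndex.GramClass.rep))
          (LiuIndex.line V (LiuIndex.repAt a₀) (LiuIndex.muLiu ι₁ LiuIndex.GramClass.rep))).Thm418C)
    (F : CMField) [IsGalois ℚ F] (h6 : 6 ≤ Module.finrank ℚ F) (f : Face F) :
    ∃ (ι₁ : F →+* ℂ) (V : HermSpace3 F ι₁) (σ : F →+* ℂ),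
      Nonempty ((picardCMUniverse hHD hI h₁ (cmAbelianVarietyRealised_of_eigenbasis hHD hI h₃)).ThetaRealisation₂ ι₁ V F f.psi σ) :=
  exists_thetaRealisation₂_face_mu hHD hI h₁ h₃ hGRU (ArchSideTerm.muSharp₂₃ @ArchSideTerm.muSlotZero) h418 F h6 f

end HodgeCM.Model

end
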